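import Literature.IUT.LogVolume.ExplicitEstimatesFaltingsComparison
import Literature.NumberTheory.DiophantineGeometry.GenEllLemma35Proofs
import Literature.NumberTheory.DiophantineGeometry.GenEllBaseChangeInvariants
import Literature.NumberTheory.EllipticCurves.HeightsBaseChangeProofs
import Mathlib.AlgebraicGeometry.EllipticCurve.ModelsWithJ
import HarnessLib

/-!
# [ExpEst] §1 Prop. 1.10 – Cor. 1.14 at the level of ELLIPTIC CURVES: the Faltings height of §0, Prop. 1.10 as
# ONE named classical fact (Löbrich 2017), and Cor. 1.14 PROVED from it with the tree's isogeny theorems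

S. Mochizuki, I. Fesenko, Y. Hoshi, A. Minamide, W. Porowski, *Explicit estimates in inter-universal Teichmüller
theory*, Kodai Math. J. **45** (2022) 175–236 — [ExpEst], bib key `MochizukiEtAl2022`; §0 "Curves" p. 184 (pdf
p10.l1–12 of the cell render `…/abc-iut/plan/repair/lit/renders/MFHMP-ExplicitEstimates-Kodai2022-book-anonnd-eeiutp`;
journal page = pdf page + 174), Prop. 1.10 / Remark 1.10.1 p. 193, Cor. 1.14 and its proof p. 194–196. The source of
Prop. 1.10: S. Löbrich, *A gap in the spectrum of the Faltings height*, JTNB **29** (2017) 289–305 [= [ExpEst]'s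
ref. [10]; held: `lit read paper:arxiv-1505.00602`], Def. 2.3 / Remark 2.1 (the normalisation `+ ½·log π`), Prop.
3.1 (Silverman's comparison with constants `C₁, C₂`; "Gaudron and Rémond showed that one can choose `C₁ = 0.72`")
and Prop. 3.2 (`C₂ = 2.071`). CLASSICAL material; nothing here is claim-tagged; TAKES NO SIDE on [IUTchIII] Cor.
3.12; no abc claim. Cell abc-iut, seat lit-abc-explicitiut (gen 4); companion of the NUMBER-LEVEL file
`ExplicitEstimatesFaltingsComparison.lean` (Lemma 1.11, Prop. 1.12, the hypothesis structure `Cor114Data`, Cor.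
1.14 (i)(ii)(iii) with all printed constants), whose hypothesis fields are CONSTRUCTED here.

## What is used from the tree (cited BY NAME)

* the stable Faltings height `WeierstrassCurve.stableFaltingsHeight` = `GenEll.EllPoint.htFalt` (Faltings' original
  normalisation; `FaltingsHeight.lean`, `GenEllMell.lean`), the presented elliptic curves `GenEll.EllPoint` with
  `htInf = [F:ℚ]⁻¹·h(j)`, `degInf = [F:ℚ]⁻¹·log N(𝔇_j)`, `localHeight`, `IsSemistable`, `AdmitsLCyclic` ([GenEll] §3);
* the three THEOREMS of the printed proof of Cor. 1.14 (i): the quotient `E_H = E/H` by an `l`-cyclic subgroup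
  scheme (`EllPoint.exists_isogeny_of_admitsLCyclic`), "`h_non(j(E_H)) = l·h_non(j(E))`" in the form `𝔇_{j(E_H)} =
  𝔇_{j(E)}^l` (`WeierstrassCurve.Isogeny.jDenominatorIdeal_eq_pow_of_degree_eq_prime`, with
  `EllPoint.not_dvd_log_valuation_j_of_isSemistable` turning "`l` prime to the local heights at the places of
  multiplicative reduction" into its hypothesis), and Faltings' isogeny inequality "`h_Fal(E_H) ≤ h_Fal(E) +
  ½·log(l)`" ([5], Lemma 5) PROVED in the tree: `WeierstrassCurve.stableFaltingsHeight_le_of_isogeny_holds`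
  — exactly the inputs that `GenEll_lemma35_general` (`GenEllLemma35Proofs.lean`) combines with the INEXPLICIT
  comparison [GenEll] Prop. 3.4; here the comparison is the EXPLICIT Prop. 1.10;
* Silverman's eq. (10) `h(j) = log N(𝔇_j) + Σ_{w∣∞} n_w·log max(|j|_w, 1)` (`logHeight₁_j_eq`), giving Remark 1.10.1
  at this level: `h_non(j(E)) = deg_∞([E])` (`hNon_j_eq_degInf`).

## The one named fact (D-0014), and why it is stated for the stable height

`ExpEst.Prop110`: "`0 ≤ (1/12)·h(j(E)) − h_Fal(E) ≤ (1/2)·log(1 + h(j(E))) + 2.071`" for every elliptic curve over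
a number field, with `h_Fal(E) := h^{stab}(E) + ½·log π` ([ExpEst] §0: "`h_Fal(E) := h^Fal(E) + ½ log π` [cf. [10],
Definition 2.3; [10], Remark 2.1] … unaffected by passage to a finite extension of the base field"). Print states
Prop. 1.10 for `E` with semi-stable reduction over `O_F` and adds (Remark 1.10.1) "the assumption that `E` has
semi-stable reduction over `O_F` is, in fact, inessential" (both sides are unchanged under finite extensions; after
an extension `E` becomes semi-stable, where the Faltings height of [5] §3 IS the stable height): the base-field-free
form over the stable height typed here is that statement. It is a theorem in print (Löbrich 2017, Prop. 3.2 for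
the upper constant `2.071`; the lower bound `0` from `C₁ = 0.72 ≥ 0` of Gaudron–Rémond quoted loc. cit.), not
proved in the tree: a NAMED FACT, consumed as the hypothesis `(h110 : Prop110)`; net debt +1, declared.

## Locator sheet (pdf = journal − 174)

§0 "Curves" p10.l4–12 ↦ `hFal` · Prop. 1.10 p19.l6–14 (+ Rmk 1.10.1 p19.l15–24) ↦ `Prop110`, `hNon_j_eq_degInf`,
`height_j_eq_htInf` · Cor. 1.14 hypotheses p20.l46 – p21.l2 ("`E` admits an `l`-cyclic subgroup scheme, … `l` is prime
to the local heights … of `E` at each of its places of [bad] multiplicative reduction") ↦ the binders `hcyc`, `hcop`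
of `exists_cor114Data` · proof of (i) p21.l41 – p22.l9 ↦ `exists_cor114Data` · (i) ↦ `cor114_i_ell`,
`cor114_i_degInf` · (ii) ↦ `hNon_j_le_kappaLog` · (iii) ↦ `hNon_j_le_of_isMonoComplex`.
-/

noncomputable section

open scoped Classical

namespace Literature.IUT.LogVolume

namespace ExpEst

open NumberField Real Cor22 IsDedekindDomain
open Literature.NumberTheory.DiophantineGeometry Literature.NumberTheory.DiophantineGeometry.GenEll

/-! ## 1. §0 "Curves": the Faltings height in [ExpEst]'s normalisation -/

/-- **[ExpEst] §0 "Curves"** (p. 184): "Write `h^Fal(E)` for the Faltings height of `E` [cf. [5], §3, the first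
Definition]. Then we shall write `h_Fal(E) := h^Fal(E) + ½·log π` [cf. [10], Definition 2.3; [10], Remark 2.1]. Here,
we note that the quantity `h_Fal(E)` is unaffected by passage to a finite extension of the base field" — for a
presented elliptic curve `E_F` (`GenEll.EllPoint`), with `h^Fal` the tree's STABLE Faltings height `EllPoint.htFalt =
WeierstrassCurve.stableFaltingsHeight` (Faltings' original normalisation; it is the Faltings height of [5] §3 of any
semi-stable model over a finite extension, cf. Remark 1.10.1). Löbrich's Remark 2.1: "The `½ log π`-term has
conventional reasons, as we follow the definition of Deligne … Faltings's original definition does not have the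
`½ log π`-term." [cite: MochizukiEtAl2022, §0 Curves p. 184] -/
def hFal (P : EllPoint) : ℝ := P.htFalt + 1 / 2 * Real.log Real.pi

/-- `h_Fal(E) = h^{stab}(E) + ½·log π` (unfolding). [cite: MochizukiEtAl2022, §0 Curves p. 184] -/
theorem hFal_eq (P : EllPoint) : hFal P = P.W.stableFaltingsHeight + 1 / 2 * Real.log Real.pi := rfl

/-! ## 2. Def. 1.1 (i) and Remark 1.10.1 for `j(E)` of a presented curve -/

/-- `h(j(E)) = ht_∞([E])`: [ExpEst]'s Weil height of `j(E)` (Def. 1.1 (i), `ExpEst.height` = Mathlib's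
`logHeight₁/[F:ℚ]`) is [GenEll]'s `EllPoint.htInf`. [cite: MochizukiEtAl2022, Def 1.1 (i) p. 184] -/
theorem height_j_eq_htInf (P : EllPoint) : height P.W.j = P.htInf := by
  rw [height_eq_logHeight₁_div]
  unfold EllPoint.htInf EllPoint.degree
  rw [div_eq_inv_mul]

/-- `h_arc(j(E)) = ht_∞([E]) − deg_∞([E])`: the archimedean part of `h(j(E))` (Def. 1.1 (i)) against Silverman's
`h(j) = log N(𝔇_j) + Σ_{w∣∞} n_w·log max(|j|_w, 1)` (the tree's `logHeight₁_j_eq`).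
[cite: MochizukiEtAl2022, Def 1.1 (i) p. 184] -/
theorem hArc_j_eq (P : EllPoint) : hArc P.W.j = P.htInf - P.degInf := by
  unfold hArc EllPoint.htInf EllPoint.degInf EllPoint.degree
  rw [logHeight₁_j_eq P.W, mul_add]
  have hs : ∑ w : InfinitePlace P.F, (w.mult : ℝ) * log⁺ (w P.W.j) =
      ∑ w : InfinitePlace P.F, (w.mult : ℝ) * Real.log (max (w P.W.j) 1) := by
    refine Finset.sum_congr rfl fun w _ => ?_
    have hw : 0 ≤ w P.W.j := by rw [← InfinitePlace.norm_embedding_eq]; exact norm_nonneg _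
    rw [Real.posLog_eq_log_max_one hw, max_comm]
  rw [hs]
  ring

/-- **[ExpEst] Remark 1.10.1 for a presented curve**: "the normalized degree of the [effective] arithmetic divisor
determined by the `q`-parameters of `E` at the elements of `𝕍(F)^non` coincides with `h_non(j(E))`" — in the tree's
[GenEll] vocabulary `h_non(j(E)) = deg_∞([E]) = [F:ℚ]⁻¹·log N(𝔇_j)` (`𝔇_j` the denominator ideal of `j(E)`; at a place
of multiplicative reduction `ord_v(𝔇_j) = −ord_v(j) = ord_v(q_E)`). [cite: MochizukiEtAl2022, Remark 1.10.1 p. 193] -/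
theorem hNon_j_eq_degInf (P : EllPoint) : hNon P.W.j = P.degInf := by
  have h1 := height_j_eq_htInf P
  have h2 := hArc_j_eq P
  unfold height at h1
  linarith

/-! ## 3. Proposition 1.10 as a named fact -/

/-- NAMED FACT — **[ExpEst] Proposition 1.10** (Comparison between `h(j(E))` and `h_Fal(E)`, I), in the
base-field-independent form licensed by its **Remark 1.10.1**: for every elliptic curve `E` over a number field,
"`0 ≤ (1/12)·h(j(E)) − h_Fal(E) ≤ (1/2)·log(1 + h(j(E))) + 2.071`", where `h(j(E))` is the Weil height of Def. 1.1 (i)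
(`ExpEst.height`, `= EllPoint.htInf`) and `h_Fal(E) = h^{stab}(E) + ½·log π` (`ExpEst.hFal`, §0 "Curves"). Print: "Let
`F` be a number field; `E` an elliptic curve over `F` that has semi-stable reduction over `O_F`. Then … Proof. This
follows immediately from [10], Proposition 3.1 [and the surrounding discussion]" and (Remark 1.10.1) "both (a) and
(b) are unaffected by passing to finite extensions of the number field `F` … In particular, the assumption that `E`
has semi-stable reduction over `O_F` is, in fact, inessential" — over a finite extension where `E` is semi-stable the
Faltings height of [5] §3 is the stable height, so the printed statement for semi-stable curves and this one are
the same assertion. SOURCE OF THE PROOF: Löbrich 2017, Prop. 3.2 ("`h(E/K) > (1/12)h(j_E) − ½ log(1+h(j_E)) +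
(1/(12[K:ℚ])) log|N(γ_{E/K})| − 2.071`", `γ_{E/K} = O_K` for semi-stable `E/K`) for the constant `2.071`, and Prop.
3.1 with "Gaudron and Rémond showed that one can choose `C₁ = 0.72`" (`≥ 0`) for the lower bound. Not proved in the
tree (it needs the `q`-expansion estimates for `Δ` and `j` on the fundamental domain, loc. cit. Lemmas 3.1–3.3).
[cite: Lobrich2017, §3 Prop. 3.2 and Prop. 3.1] [cite: MochizukiEtAl2022, Prop 1.10 p. 193] -/
def Prop110 : Prop :=
  ∀ P : EllPoint, Prop110Ineq (height P.W.j) (hFal P)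

/-! ## 4. The hypotheses of Cor. 1.14 construct `Cor114Data` (proof of (i), p. 195–196) -/

/-- **Proof of [ExpEst] Cor. 1.14 (i), the inputs** (p. 195–196): for a presented SEMI-STABLE `E_F`, a prime `l`, an
`l`-cyclic subgroup scheme `H ⊆ E` ("[cf. [15], Lemma 3.5]", `EllPoint.AdmitsLCyclic`) with "`l` prime to the local
heights [cf. [15], Definition 3.3] of `E` at each of its places of [bad] multiplicative reduction", and Prop. 1.10
(`h110`), the number-level datum `Cor114Data (h_non(j(E))) (h_arc(j(E))) l` EXISTS with `h_Fal(E) = hFal E`: "Write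
`E_H := E/H`. [In particular, `E_H` is isogenous to `E` …] Thus, by applying the same arguments as those applied in
the proof of [15], Lemma 3.5, we obtain … `h_non(j(E_H)) = l·h_non(j(E))` [cf. also Remark 1.10.1]. On the other
hand, it follows from …; [5], Lemma 5, that … `h_Fal(E_H) ≤ h_Fal(E) + ½·log(l)`" — the quotient isogeny
(`exists_isogeny_of_admitsLCyclic`), `𝔇_{j(E_H)} = 𝔇_{j(E)}^l` (`Isogeny.jDenominatorIdeal_eq_pow_of_degree_eq_prime`)
and Faltings' inequality (`stableFaltingsHeight_le_of_isogeny_holds`), all tree theorems; Prop. 1.10 is applied to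
`E` and to `E_H`. [cite: MochizukiEtAl2022, Cor 1.14 (i) proof p. 195–196] -/
theorem exists_cor114Data (h110 : Prop110) (P : EllPoint) (hss : P.IsSemistable) {l : ℕ} (hl : l.Prime)
    (hcyc : P.AdmitsLCyclic l)
    (hcop : ∀ v : HeightOneSpectrum (𝓞 P.F), P.W.HasMultiplicativeReductionAt v →
      ¬ ((l : ℤ) ∣ P.localHeight v)) :
    ∃ D : Cor114Data (hNon P.W.j) (hArc P.W.j) l, D.hFalE = hFal P := by
  haveI : Fact l.Prime := ⟨hl⟩
  obtain ⟨W', hW', g, hdeg⟩ := P.exists_isogeny_of_admitsLCyclic hl hcyc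
  -- the quotient `E_H`, presented over the same field
  set P' : EllPoint := @EllPoint.mk P.F _ _ W' hW' with hP'
  -- Faltings' isogeny inequality ([5], Lemma 5)
  have hF : P'.htFalt ≤ P.htFalt + 1 / 2 * Real.log l := by
    have h := WeierstrassCurve.stableFaltingsHeight_le_of_isogeny_holds P.W W' g
    rw [hdeg] at h
    exact h
  -- `deg_∞(E_H) = l·deg_∞(E)`, i.e. `h_non(j(E_H)) = l·h_non(j(E))`
  have hD : P'.degInf = l * P.degInf := by
    have hideal := WeierstrassCurve.Isogeny.jDenominatorIdeal_eq_pow_of_degree_eq_prime g hdeg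
      (P.not_dvd_log_valuation_j_of_isSemistable hss hcop)
    show (P'.degree : ℝ)⁻¹ * Real.log (Ideal.absNorm W'.jDenominatorIdeal) =
      l * ((P.degree : ℝ)⁻¹ * Real.log (Ideal.absNorm P.W.jDenominatorIdeal))
    have hdd : P'.degree = P.degree := rfl
    rw [hdd, hideal, map_pow, Nat.cast_pow, Real.log_pow]
    ring
  refine ⟨{ hFalE := hFal P
            hNonEH := hNon P'.W.j
            hArcEH := hArc P'.W.j
            hFalEH := hFal P'
            hArcEH_nonneg := hArc_nonneg _
            prop110_E := h110 P
            prop110_EH := h110 P'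
            hNon_isog := by rw [hNon_j_eq_degInf, hNon_j_eq_degInf]; exact hD
            hFal_isog := by unfold hFal; linarith }, rfl⟩

/-! ## 5. Corollary 1.14 for elliptic curves -/

/-- **[ExpEst] Corollary 1.14 (i)** for a presented semi-stable elliptic curve `E_F` with an `l`-cyclic subgroup
scheme, `l` prime to the local heights at the places of multiplicative reduction, from Prop. 1.10 (`h110`): "`(l/
(12(1+x)))·h_non(j(E)) ≤ h_Fal(E) + (1/2)·log(l) + C(x)`" (`x > 0`). [cite: MochizukiEtAl2022, Cor 1.14 (i) p. 194] -/
theorem cor114_i_ell (h110 : Prop110) (P : EllPoint) (hss : P.IsSemistable) {l : ℕ} (hl : l.Prime)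
    (hcyc : P.AdmitsLCyclic l)
    (hcop : ∀ v : HeightOneSpectrum (𝓞 P.F), P.W.HasMultiplicativeReductionAt v →
      ¬ ((l : ℤ) ∣ P.localHeight v)) {x : ℝ} (hx : 0 < x) :
    (l : ℝ) / (12 * (1 + x)) * hNon P.W.j ≤ hFal P + 1 / 2 * Real.log l + C112 x := by
  obtain ⟨D, hD⟩ := exists_cor114Data h110 P hss hl hcyc hcop
  have h := cor114_i D (hNon_nonneg _) hx
  rwa [hD] at h

/-- Cor. 1.14 (i) in [GenEll]'s vocabulary — the EXPLICIT counterpart of [GenEll] Lemma 3.5 (`GenEll_lemma35_general`: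
`(1/(12(1+ε)))·l·deg_∞(E) ≤ ht^Falt(E) + 2·log(l) + C` with an inexplicit `C`): `(l/(12(1+x)))·deg_∞([E]) ≤
ht^Falt([E]) + ½·log π + ½·log(l) + C(x)`, from Prop. 1.10 (`h110`). [cite: MochizukiEtAl2022, Cor 1.14 (i) p. 194] -/
theorem cor114_i_degInf (h110 : Prop110) (P : EllPoint) (hss : P.IsSemistable) {l : ℕ} (hl : l.Prime)
    (hcyc : P.AdmitsLCyclic l)
    (hcop : ∀ v : HeightOneSpectrum (𝓞 P.F), P.W.HasMultiplicativeReductionAt v →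
      ¬ ((l : ℤ) ∣ P.localHeight v)) {x : ℝ} (hx : 0 < x) :
    (l : ℝ) / (12 * (1 + x)) * P.degInf ≤
      P.htFalt + 1 / 2 * Real.log Real.pi + 1 / 2 * Real.log l + C112 x := by
  have h := cor114_i_ell h110 P hss hl hcyc hcop hx
  rw [hNon_j_eq_degInf] at h
  exact h

/-- **[ExpEst] Corollary 1.14 (ii)** for elliptic curves: `E_F` presented and semi-stable, `E ≅ {y² = x(x−1)(x−λ)}`
with `λ ∈ F` (`j(E) = j(λ) = 2^8(λ²−λ+1)³/(λ²(λ−1)²)`, `Cor22.jInv`) and `λ ∈ 𝒦_{𝕍(ℚ)^arc}(κ)` (`0 < κ ≤ 1`, Def. 1.13;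
`MemKArc`), `l ≥ 10^15` a prime, an `l`-cyclic subgroup scheme with `l` prime to the local heights at the places of
multiplicative reduction, and Prop. 1.10 (`h110`): "`h_non(j(E)) ≤ 5·10⁻¹³ − 6.01·10⁻¹⁵·log(κ)`" `= κ^log`
(`ExpEst.kappaLog κ`). [cite: MochizukiEtAl2022, Cor 1.14 (ii) p. 195] -/
theorem hNon_j_le_kappaLog (h110 : Prop110) (P : EllPoint) (hss : P.IsSemistable) {l : ℕ} (hl : l.Prime)
    (hl15 : (10 : ℝ) ^ 15 ≤ l) (hcyc : P.AdmitsLCyclic l)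
    (hcop : ∀ v : HeightOneSpectrum (𝓞 P.F), P.W.HasMultiplicativeReductionAt v →
      ¬ ((l : ℤ) ∣ P.localHeight v))
    (t : P.F) (h0 : t ≠ 0) (h1 : t ≠ 1) (hj : P.W.j = jInv t) {κ : ℝ} (hκ0 : 0 < κ) (hκ1 : κ ≤ 1)
    (hK : MemKArc κ ({ F := P.F, x := t } : NFPoint)) :
    hNon P.W.j ≤ kappaLog κ := by
  obtain ⟨D, -⟩ := exists_cor114Data h110 P hss hl hcyc hcop
  have harc : hArc P.W.j ≤ 11 * Real.log 2 - 3 * Real.log κ := by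
    rw [hj]
    exact hArc_jInv_le_of_memKArc hκ0 { F := P.F, x := t } ⟨h0, h1⟩ hK
  exact cor114_ii_le_kappaLog D (hNon_nonneg _) hl15 hκ0 hκ1 harc

/-- **[ExpEst] Corollary 1.14 (iii)** for elliptic curves: `E_F` presented over a MONO-COMPLEX `F` (Def. 1.2;
"`ℚ(λ)` is mono-complex" rendered as in Prop. 1.9) and semi-stable, `E ≅ {y² = x(x−1)(x−λ)}` with `λ ∈ F`, `l ≥ 10^15`
a prime, an `l`-cyclic subgroup scheme with `l` prime to the local heights at the places of multiplicative
reduction, and Prop. 1.10 (`h110`): "`h_non(j(E)) ≤ 5.12·10⁻¹³`". [cite: MochizukiEtAl2022, Cor 1.14 (iii) p. 195] -/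
theorem hNon_j_le_of_isMonoComplex (h110 : Prop110) (P : EllPoint) (hF : IsMonoComplex P.F)
    (hss : P.IsSemistable) {l : ℕ} (hl : l.Prime) (hl15 : (10 : ℝ) ^ 15 ≤ l) (hcyc : P.AdmitsLCyclic l)
    (hcop : ∀ v : HeightOneSpectrum (𝓞 P.F), P.W.HasMultiplicativeReductionAt v →
      ¬ ((l : ℤ) ∣ P.localHeight v))
    (t : P.F) (h0 : t ≠ 0) (h1 : t ≠ 1) (hj : P.W.j = jInv t) :
    hNon P.W.j ≤ 5.12 / 10 ^ 13 := by
  obtain ⟨D, -⟩ := exists_cor114Data h110 P hss hl hcyc hcop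
  have h19 : hArc P.W.j ≤ hNon P.W.j + 19 * Real.log 2 := by
    rw [hj]
    exact hArc_jInv_le hF t h0 h1
  exact cor114_iii_le D (hNon_nonneg _) hl15 h19

/-! ## 6. Invariance under finite extension of the base field (§0 "Curves"; Remark 1.10.1) -/

section BaseChange

variable (P : EllPoint) (L' : Type) [Field L'] [NumberField L'] [Algebra P.F L']

/-- **[ExpEst] §0 "Curves"**: "the quantity `h_Fal(E)` is unaffected by passage to a finite extension of the base field
`F` of `E` [cf., e.g., [10], Proposition 2.1, (i)]" — for `E_{L′} = E ×_F L′`; the tree's `EllPoint.htFalt_baseChange`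
(`stableFaltingsHeight_map_holds`). [cite: MochizukiEtAl2022, §0 Curves p. 184] -/
theorem hFal_baseChange :
    hFal ({ F := L', W := P.W.map (algebraMap P.F L') } : EllPoint) = hFal P := by
  unfold hFal
  rw [EllPoint.htFalt_baseChange]

/-- **[ExpEst] Remark 1.10.1**: "both (a) [the normalized degree of the `q`-parameter divisor] and (b) [`h_non(j(E))`]
are unaffected by passing to finite extensions of the number field `F`" — `h_non(j(E_{L′})) = h_non(j(E))`, via
`hNon_j_eq_degInf` and the tree's `EllPoint.degInf_baseChange`. [cite: MochizukiEtAl2022, Remark 1.10.1 p. 193] -/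
theorem hNon_j_baseChange :
    hNon ({ F := L', W := P.W.map (algebraMap P.F L') } : EllPoint).W.j = hNon P.W.j := by
  rw [hNon_j_eq_degInf, hNon_j_eq_degInf, EllPoint.degInf_baseChange]

end BaseChange

/-! ## 7. Remark 1.7.1 for `h`, `h_non`, `h_arc` of an element, and Cor. 1.14 (iii) with `λ` in a mono-complex subfield -/

section ElementBaseChange

variable {K L : Type} [Field K] [NumberField K] [Field L] [NumberField L] [Algebra K L]

/-- **[ExpEst] Remark 1.7.1** ("`h^{(𝔖-)tor}_□(−)` is unaffected by passage to finite extensions of the base field"),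
the case of the Weil height `h` of Def. 1.1 (i): `h(x)` computed in `L ⊇ K` equals `h(x)` computed in `K` — from the
tree's `NumberField.logHeight₁_algebraMap` (`h_L = [L:K]·h_K`, Silverman AEC VIII.5.4 (b)).
[cite: MochizukiEtAl2022, Remark 1.7.1 p. 190] -/
theorem height_algebraMap (x : K) : height (algebraMap K L x) = height x := by
  haveI : Module.Finite K L := Module.Finite.of_restrictScalars_finite ℚ K L
  haveI : IsScalarTower ℚ K L := IsScalarTower.of_algebraMap_eq fun q => by simp
  rw [height_eq_logHeight₁_div, height_eq_logHeight₁_div, NumberField.logHeight₁_algebraMap,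
    ← Module.finrank_mul_finrank ℚ K L]
  have hk : (Module.finrank K L : ℝ) ≠ 0 := by exact_mod_cast Module.finrank_pos.ne'
  have hd : (Module.finrank ℚ K : ℝ) ≠ 0 := by exact_mod_cast Module.finrank_pos.ne'
  push_cast
  field_simp

/-- **[ExpEst] Remark 1.7.1**, the case of `h_non` (Def. 1.1 (i)): `h_non(x)` is unchanged under `K ⊆ L` — via an
elliptic curve over `K` with `j`-invariant `x` (Mathlib `WeierstrassCurve.ofJ`), `hNon_j_eq_degInf` and the tree's
`EllPoint.degInf_baseChange`. [cite: MochizukiEtAl2022, Remark 1.7.1 p. 190] -/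
theorem hNon_algebraMap (x : K) : hNon (algebraMap K L x) = hNon x := by
  have h := hNon_j_baseChange ({ F := K, W := WeierstrassCurve.ofJ x } : EllPoint) L
  change hNon ((WeierstrassCurve.ofJ x).map (algebraMap K L)).j = hNon (WeierstrassCurve.ofJ x).j at h
  rwa [WeierstrassCurve.map_j, WeierstrassCurve.ofJ_j] at h

/-- **[ExpEst] Remark 1.7.1**, the case of `h_arc` (Def. 1.1 (i)): `h_arc(x)` is unchanged under `K ⊆ L`
(`h_arc = h − h_non`). [cite: MochizukiEtAl2022, Remark 1.7.1 p. 190] -/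
theorem hArc_algebraMap (x : K) : hArc (algebraMap K L x) = hArc x := by
  have h1 := height_algebraMap (L := L) x
  have h2 := hNon_algebraMap (L := L) x
  unfold height at h1
  linarith

end ElementBaseChange

/-- **[ExpEst] Corollary 1.14 (iii)** for elliptic curves, with "`ℚ(λ)` is mono-complex" rendered by a mono-complex
field `F₀ ∋ λ` mapping to the field of definition `F` of `E` (the situation of the proof of Cor. 5.2, step (P4), p. 215:
`λ ∈ F_tpd` mono-complex, `E_F` over `F = F_tpd(√−1, E[3·5])`): `E_F` semi-stable with `j(E) = j(λ)`, `l ≥ 10^15` a prime, an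
`l`-cyclic subgroup scheme with `l` prime to the local heights at the places of multiplicative reduction, and Prop. 1.10
(`h110`) give "`h_non(j(E)) ≤ 5.12·10⁻¹³`" (Prop. 1.9 (ii) in `F₀`, transported by Remark 1.7.1).
[cite: MochizukiEtAl2022, Cor 1.14 (iii) p. 195] -/
theorem hNon_j_le_of_isMonoComplex_subfield (h110 : Prop110) (P : EllPoint) (F₀ : Type) [Field F₀]
    [NumberField F₀] [Algebra F₀ P.F] (hF₀ : IsMonoComplex F₀) (hss : P.IsSemistable) {l : ℕ} (hl : l.Prime)
    (hl15 : (10 : ℝ) ^ 15 ≤ l) (hcyc : P.AdmitsLCyclic l)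
    (hcop : ∀ v : HeightOneSpectrum (𝓞 P.F), P.W.HasMultiplicativeReductionAt v →
      ¬ ((l : ℤ) ∣ P.localHeight v))
    (t : F₀) (h0 : t ≠ 0) (h1 : t ≠ 1) (hj : P.W.j = algebraMap F₀ P.F (jInv t)) :
    hNon P.W.j ≤ 5.12 / 10 ^ 13 := by
  obtain ⟨D, -⟩ := exists_cor114Data h110 P hss hl hcyc hcop
  have h19 : hArc P.W.j ≤ hNon P.W.j + 19 * Real.log 2 := by
    rw [hj, hArc_algebraMap, hNon_algebraMap]
    exact hArc_jInv_le hF₀ t h0 h1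
  exact cor114_iii_le D (hNon_nonneg _) hl15 h19

end ExpEst

end Literature.IUT.LogVolume

end
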